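import Literature.IUT.LogVolume.SubThetaFieldRamificationThirty
import Literature.NumberTheory.EllipticCurves.MultiplicativeUnramifiedTorsionProofs
import Literature.NumberTheory.EllipticCurves.DivisionFieldRamificationPotMultLevelProofs
import Literature.NumberTheory.EllipticCurves.MultiplicativeReductionJValuationProofs
import HarnessLib

/-!
# The ramification of a field pinned by the v3 Θ-datum at a BAD place `v ∤ 30`: the TATE-EXACT refinement
# `3 ∣ ord_v j(λ) ⇒ e(w | v) ∣ 10`, `5 ∣ ord_v j(λ) ⇒ e(w | v) ∣ 6`, `15 ∣ ord_v j(λ) ⇒ e(w | v) ∣ 2` (proof-only)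

J.-P. Serre, *Propriétés galoisiennes des points d'ordre fini des courbes elliptiques*, Invent. Math. **15** (1972),
§1.11–§1.12 (courbes de Tate: over `K_v^{nr}` one has `E[p] ≅ ⟨ζ_p, q^{1/p}⟩`, so the inertia group acts trivially on
`E[p]` iff `p ∣ v(q) = v(Δ_min) = −v(j)`); J.-P. Serre, *Local Fields*, Ch. IV §2 Cor. 1 and Cor. 3 of Prop. 7;
S. Mochizuki, *Inter-universal Teichmüller theory IV*, Thm. 1.10 Step (iii) (R2)–(R4) p. 25–26 (locus of use only).

abc-iut-W-neg-1's `Cor22.ramificationIdx_subThetaField_dvd_thirty` (`SubThetaFieldRamificationThirty`, p461051) proves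
`e(w | v) ∣ 30` for a place `w` of a field `F` pinned by `IsSubThetaField P F`
(`F ⊆ F_tpd(√−1, √λ, √(λ−1), E_λ[15])`, Galois over `F_tpd`) over a BAD place `v ∤ 30` of `λ`: the image of the absolute
inertia group `I = I_𝔓` in `Gal(F/F_tpd)` is CYCLIC, generated by the class of one `s ∈ I`, and `s^{30} = (s²)^{15}` fixes
`F` because `s²` fixes every square root and lies in `Γ_{F_tpd(√d)}` for a multiplicative twist `E_λ^{(d)}` at `v`, where
`ρ̄_{E_λ,3}`, `ρ̄_{E_λ,5}` are UNIPOTENT along inertia. THIS FILE replaces unipotence by TRIVIALITY whenever the Tate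
criterion applies: if `3 ∣ ord_v Δ_min(E_λ^{(d)}) = −ord_v j(λ)` then the inertia group fixes `E_λ^{(d)}[3]` pointwise
(the tree's `WeierstrassCurve.smul_geomTorsion_eq_of_mem_inertia_of_hasMultiplicativeReductionAt_of_dvd`,
`MultiplicativeUnramifiedTorsionProofs`, proved there WITHOUT the Tate curve from Kodaira–Néron), hence — transported to
`E_λ` on `Γ_{F_tpd(√d)}` by the tree's `ker_galoisRepTorsion_quadraticTwist_inf_stabilizer_le` — `ρ̄_{E_λ,3}(s²) = 1`, so
already `s^{10} = (s²)^5` fixes `F`; symmetrically for `5`; the link `ord_v Δ_min = −ord_v j` at a multiplicative place is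
the tree's `natCast_dvd_log_valuation_j_iff` with `j(E^{(d)}) = j(E_λ) = j(λ)`:

* `Cor22.ramificationIdx_subThetaField_dvd_two_mul_of_forall_inertia` — the cyclic-tame-inertia argument ABSTRACTED:
  if for every multiplicative twist `E_λ^{(d)}` at `v` and every `σ ∈ I_𝔓 ∩ Γ_{F_tpd(√d)}` one has `ρ̄₃(σ)^k = ρ̄₅(σ)^k = 1`,
  then `e(w | v) ∣ 2k` (`k = 15` is p461051);
* **`Cor22.ramificationIdx_subThetaField_dvd_ten_of_three_dvd_ord`** — `3 ∣ ord_v j(λ)` ⇒ **`e(w | v) ∣ 10`**;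
* **`Cor22.ramificationIdx_subThetaField_dvd_six_of_five_dvd_ord`** — `5 ∣ ord_v j(λ)` ⇒ **`e(w | v) ∣ 6`**;
* **`Cor22.ramificationIdx_subThetaField_dvd_two_of_fifteen_dvd_ord`** — `15 ∣ ord_v j(λ)` ⇒ **`e(w | v) ∣ 2`**.

Numerically this is the exact local type `e ∈ {e_x, 2e_x}`, `e_x = 15/gcd(15, ord_v q)`, of the abc-iut R-W window table
(rw-num-lead WINDOW-TABLE v1 A1 / kit N1b; TARGETS.tsv kind TE «genuine e_w»). Consumer: the TE rows of
HOME/plan/rescue/R-W/TARGETS.tsv at pole primes `p < 30·l + 2` (abc-iut-W-ref-2, rows 26–51).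
Proof-only (no definition, no named fact); classical; TAKES NO SIDE on [IUTchIII] Cor. 3.12.
-/

noncomputable section

open scoped Classical

namespace Literature.IUT.LogVolume

namespace Cor22

open NumberField IsDedekindDomain Literature.NumberTheory.DiophantineGeometry.GenEll
open Literature.NumberTheory.EllipticCurves Literature.NumberTheory.GaloisRepresentations
open Literature.NumberTheory.NumberFields WeierstrassCurve IntermediateField Field

variable {P : NFPoint} (F : Type) [Field F] [NumberField F] [Algebra P.F F]

/-- **The cyclic-tame-inertia argument, abstract form: `e(w | v) ∣ 2k`.** `P ∈ U`, `F` Galois over `F_tpd` with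
`IsSubThetaField P F`, `w | v` with `v ∈ badPlaces P` and `30 ∉ v`. Suppose that for every prime `𝔓 | v` of `\bar ℤ_{F_tpd}`,
every `d ≠ 0` with `E_λ^{(d)}` of multiplicative reduction at `v`, and every `σ` in the inertia group `I_𝔓` fixing `√d`,
`ρ̄_{E_λ,3}(σ)^k = 1` and `ρ̄_{E_λ,5}(σ)^k = 1`. THEN `e(w | v) ∣ 2k`: the image of `I_𝔓` in `Gal(F/F_tpd)` is cyclic,
generated by the class of one `s ∈ I_𝔓` (tame descent, Serre IV §2 Cor. 1, 3), `s²` fixes `√−1, √λ, √(λ−1), √d`, and so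
`s^{2k} = (s²)^k` fixes `E_λ[15]`, i.e. `s^{2k} ∈ Γ_F`. (abc-iut-W-neg-1's p461051 is `k = 15` via unipotence.)
[cite: SerreLocalFields1979, Ch. IV §2 Cor. 1 and Cor. 3 of Prop. 7] [cite: Serre1972, §1.11–§1.12]
[cite: Mochizuki2012, IUTchIV Thm 1.10 proof Step (iii) (R2)–(R4) p.25–26] -/
theorem ramificationIdx_subThetaField_dvd_two_mul_of_forall_inertia (hU : P.InU) (hF : IsSubThetaField P F)
    [IsGalois P.F F] (w : HeightOneSpectrum (𝓞 F)) (hbad : finBelow P.F F w ∈ badPlaces P)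
    (h30 : ((30 : ℕ) : 𝓞 P.F) ∉ (finBelow P.F F w).asIdeal) (k : ℕ)
    (H : ∀ (𝔓 : Ideal (absIntegers (𝓞 P.F) P.F)), 𝔓 ∈ (finBelow P.F F w).primesAbove → ∀ (d : P.F), d ≠ 0 →
      (P.legendreCurve.quadraticTwist d).HasMultiplicativeReductionAt (finBelow P.F F w) →
      ∀ σ ∈ 𝔓.inertia (absoluteGaloisGroup P.F), σ • geomSqrt d = geomSqrt d →
        P.legendreCurve.galoisRepTorsion ((3 : ℕ) : ℤ) σ ^ k = 1 ∧
          P.legendreCurve.galoisRepTorsion ((5 : ℕ) : ℤ) σ ^ k = 1) :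
    w.asIdeal.ramificationIdx (𝓞 P.F) ∣ 2 * k := by
  haveI : P.legendreCurve.IsElliptic := P.legendreCurve_isElliptic_iff.2 hU
  haveI : Fact (Nat.Prime 3) := ⟨Nat.prime_three⟩
  haveI : Fact (Nat.Prime 5) := ⟨Nat.prime_five⟩
  set v := finBelow P.F F w with hvdef
  haveI := v.isPrime
  -- residue characteristic `∉ {2, 3, 5}`
  have h2 : ((2 : ℕ) : 𝓞 P.F) ∉ v.asIdeal := fun h => h30 (by
    rw [show (30 : ℕ) = 15 * 2 from rfl, Nat.cast_mul]; exact Ideal.mul_mem_left _ _ h)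
  have h3 : ((3 : ℕ) : 𝓞 P.F) ∉ v.asIdeal := fun h => h30 (by
    rw [show (30 : ℕ) = 10 * 3 from rfl, Nat.cast_mul]; exact Ideal.mul_mem_left _ _ h)
  have h5 : ((5 : ℕ) : 𝓞 P.F) ∉ v.asIdeal := fun h => h30 (by
    rw [show (30 : ℕ) = 6 * 5 from rfl, Nat.cast_mul]; exact Ideal.mul_mem_left _ _ h)
  -- `F ≃ L := F_tpd(φ S) ⊆ F̄_tpd`
  haveI : FiniteDimensional P.F F := Module.Finite.of_restrictScalars_finite ℚ P.F F
  set Ω := AlgebraicClosure P.F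
  let φ : F →ₐ[P.F] Ω := IsAlgClosed.lift
  set S : Set F := subThetaFieldGenerators P F with hSdef
  set L : IntermediateField P.F Ω := IntermediateField.adjoin P.F (φ '' S) with hLdef
  have hL : φ.fieldRange = L := by
    rw [AlgHom.fieldRange_eq_map, ← hF.adjoin_eq_top, IntermediateField.adjoin_map]
  let e : F ≃ₐ[P.F] L :=
    (((IntermediateField.topEquiv (F := P.F) (E := F)).symm.trans (IntermediateField.equivMap ⊤ φ)).trans
      (IntermediateField.equivOfEq (AlgHom.fieldRange_eq_map φ).symm)).trans
      (IntermediateField.equivOfEq hL)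
  haveI : FiniteDimensional P.F L := LinearEquiv.finiteDimensional e.toLinearEquiv
  haveI : IsGalois P.F L := IsGalois.of_algEquiv e
  haveI : NumberField L := NumberField.of_module_finite P.F L
  -- `[L : F_tpd] ∣ 2¹²·3²·5`
  have hdegL : Module.finrank P.F L ∣ 2 ^ 12 * 3 ^ 2 * 5 := by
    rw [← e.toLinearEquiv.finrank_eq]
    exact hF.finrank_dvd_bound P hU
  -- absolute inertia at `v`
  obtain ⟨𝔓, h𝔓⟩ := HeightOneSpectrum.primesAbove_nonempty v
  haveI : 𝔓.IsPrime := h𝔓.1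
  haveI : 𝔓.LiesOver v.asIdeal := h𝔓.2
  set I : Subgroup (absoluteGaloisGroup P.F) := 𝔓.inertia (absoluteGaloisGroup P.F) with hIdef
  -- (1) the restriction of `I` to `Gal(L/F_tpd) = Γ/Γ_L` is CYCLIC, generated by the class of some `s ∈ I`
  set N₀ : Subgroup (absoluteGaloisGroup P.F) := L.fixingSubgroup with hN₀
  haveI hN₀n : N₀.Normal := IsGalois.fixingSubgroup_normal_of_isGalois L
  have hN₀open : IsOpen (N₀ : Set (absoluteGaloisGroup P.F)) := IntermediateField.fixingSubgroup_isOpen L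
  haveI : DiscreteTopology (absoluteGaloisGroup P.F ⧸ N₀) := QuotientGroup.discreteTopology hN₀open
  let π : absoluteGaloisGroup P.F →ₜ* (absoluteGaloisGroup P.F ⧸ N₀) :=
    ⟨QuotientGroup.mk' N₀, QuotientGroup.continuous_mk⟩
  have hπ : π.toMonoidHom = QuotientGroup.mk' N₀ := rfl
  -- tameness: the residue characteristic does not divide `[L : F_tpd] = [Γ : Γ_L]`
  have htame : ¬ ringChar (𝓞 P.F ⧸ v.asIdeal) ∣ N₀.index := by
    haveI : Finite (𝓞 P.F ⧸ v.asIdeal) := Ideal.finiteQuotientOfFreeOfNeBot v.asIdeal v.ne_bot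
    letI : Field (𝓞 P.F ⧸ v.asIdeal) := Ideal.Quotient.field _
    set p : ℕ := ringChar (𝓞 P.F ⧸ v.asIdeal) with hpdef
    have hpprime : p.Prime := CharP.char_is_prime (𝓞 P.F ⧸ v.asIdeal) p
    have hpv : ((p : ℕ) : 𝓞 P.F) ∈ v.asIdeal := by
      rw [← Ideal.Quotient.eq_zero_iff_mem, map_natCast, hpdef]
      exact ringChar.Nat.cast_ringChar
    have hidx : N₀.index = Module.finrank P.F L := (IntermediateField.finrank_eq_fixingSubgroup_index L).symm
    rw [hidx]
    intro h
    have h' := h.trans hdegL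
    rcases (Nat.Prime.dvd_mul hpprime).1 h' with h23 | h5'
    · rcases (Nat.Prime.dvd_mul hpprime).1 h23 with h2' | h3'
      · exact h2 (((Nat.prime_dvd_prime_iff_eq hpprime Nat.prime_two).1 (hpprime.dvd_of_dvd_pow h2')) ▸ hpv)
      · exact h3 (((Nat.prime_dvd_prime_iff_eq hpprime Nat.prime_three).1 (hpprime.dvd_of_dvd_pow h3')) ▸ hpv)
    · exact h5 (((Nat.prime_dvd_prime_iff_eq hpprime Nat.prime_five).1 h5') ▸ hpv)
  have hwild : ∀ u : ℝ, 0 < u → ∀ σ ∈ absUpperRamificationSubgroup (𝓞 P.F) 𝔓 u, π σ = 1 := by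
    intro u hu σ hσ
    have hσN : σ ∈ N₀ := absUpperRamificationSubgroup_le_of_not_dvd_index h𝔓 N₀ hN₀open htame hu hσ
    exact (QuotientGroup.eq_one_iff σ).2 hσN
  obtain ⟨s, hs, hcyc⟩ := exists_map_inertia_eq_zpowers_of_forall_absUpperRamificationSubgroup h𝔓 π hwild
  -- (2) `s^{2k}` fixes `L`
  -- every square root is fixed by `s²` (index `∣ 2`, normal)
  have hsq : ∀ a : P.F, s ^ 2 ∈ sqrtFixer P a := by
    intro a
    haveI : IsGalois P.F (adjoin P.F {z : AlgebraicClosure P.F | z ^ 2 = algebraMap P.F _ a}) := isGalois_adjoin_sqrtSet _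
    haveI : (sqrtFixer P a).Normal := IsGalois.fixingSubgroup_normal_of_isGalois _
    have hidx : (sqrtFixer P a).index ∣ 2 := index_fixingSubgroup_adjoin_sqrtSet_dvd_two a
    have hmem : s ^ (sqrtFixer P a).index ∈ sqrtFixer P a := Subgroup.pow_index_mem _ s
    rcases (Nat.dvd_prime Nat.prime_two).1 hidx with h1 | h2i
    · rw [h1, pow_one] at hmem
      exact Subgroup.pow_mem _ hmem 2
    · rwa [h2i] at hmem
  -- a multiplicative quadratic twist of `E_λ` at the bad place `v`; `s² ∈ Γ_{F_tpd(√d)}`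
  have hord : ord P.F v (jInv P.x) < 0 := (mem_badPlaces_iff_ord_neg P v).1 hbad
  have hj0 : jInv P.x ≠ 0 := fun h0 => by
    rw [h0, ord_zero] at hord
    exact lt_irrefl _ hord
  have hj : 1 < v.valuation P.F P.legendreCurve.j := by
    have hjl : P.legendreCurve.j = jInv P.x := j_legendre P hU
    rw [hjl]
    exact (ord_neg_iff_one_lt_valuation P.F v hj0).1 hord
  obtain ⟨d, hd, hmult⟩ := P.legendreCurve.exists_hasMultiplicativeReductionAt_quadraticTwist_of_one_lt_valuation_j v hj
  set N : Subgroup (absoluteGaloisGroup P.F) := MulAction.stabilizer (absoluteGaloisGroup P.F) (geomSqrt d) with hNdef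
  haveI hNn : N.Normal := stabilizer_geomSqrt_normal d
  have hs2N : s ^ 2 ∈ N := by
    have hmem : s ^ N.index ∈ N := Subgroup.pow_index_mem _ s
    rcases index_stabilizer_geomSqrt (K := P.F) d with h1 | h2i
    · rw [h1, pow_one] at hmem
      exact Subgroup.pow_mem _ hmem 2
    · rw [hNdef, h2i] at hmem; exact hmem
  have hs2I : s ^ 2 ∈ I := Subgroup.pow_mem _ hs 2
  have hs2d : s ^ 2 • geomSqrt d = geomSqrt d := MulAction.mem_stabilizer_iff.1 hs2N
  -- the hypothesis at `σ = s²`: `ρ̄_p(s^{2k}) = ρ̄_p(s²)^k = 1` for `p = 3, 5`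
  obtain ⟨hk3, hk5⟩ := H 𝔓 h𝔓 d hd hmult (s ^ 2) hs2I hs2d
  have h3ker : s ^ (2 * k) ∈ (P.legendreCurve.galoisRepTorsion ((3 : ℕ) : ℤ)).ker := by
    rw [MonoidHom.mem_ker, pow_mul, map_pow, hk3]
  have h5ker : s ^ (2 * k) ∈ (P.legendreCurve.galoisRepTorsion ((5 : ℕ) : ℤ)).ker := by
    rw [MonoidHom.mem_ker, pow_mul, map_pow, hk5]
  have hsq2k : ∀ a : P.F, s ^ (2 * k) ∈ sqrtFixer P a := fun a => by
    rw [pow_mul]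
    exact Subgroup.pow_mem _ (hsq a) k
  -- hence `s^{2k}` fixes every generator of `L`
  have hs2k : s ^ (2 * k) ∈ N₀ := by
    set τ := s ^ (2 * k) with hτ
    refine mem_fixingSubgroup_adjoin_of_forall_eq (σ := Field.absoluteGaloisGroup.toAlgEquiv P.F τ) fun t ht => ?_
    obtain ⟨x, hx, rfl⟩ := ht
    rcases hx with (hsq' | hsq' | hsq') | htor
    · -- `x² = −1`
      have : (φ x) ^ 2 = algebraMap P.F Ω (-1) := by rw [← map_pow, hsq', map_neg, map_one, map_neg, map_one]
      exact forall_eq_of_mem_fixingSubgroup_adjoin (hsq2k (-1)) _ this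
    · -- `x² = λ`
      have : (φ x) ^ 2 = algebraMap P.F Ω P.x := by rw [← map_pow, hsq', φ.commutes]
      exact forall_eq_of_mem_fixingSubgroup_adjoin (hsq2k P.x) _ this
    · -- `x² = λ − 1`
      have : (φ x) ^ 2 = algebraMap P.F Ω (P.x - 1) := by
        rw [← map_pow, hsq', map_sub, map_one, φ.commutes, map_sub, map_one]
      exact forall_eq_of_mem_fixingSubgroup_adjoin (hsq2k (P.x - 1)) _ this
    · -- a `15`-torsion coordinate
      rw [torsionCoords_eq] at htor
      obtain ⟨T, hT, hxT⟩ := Set.mem_iUnion₂.1 htor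
      have hT15 : (15 : ℤ) • T = 0 := hT
      let T' : geomPoints P.legendreCurve := Affine.Point.map (W' := P.legendreCurve.toAffine) φ T
      have hT' : (15 : ℤ) • T' = 0 := by
        change (15 : ℤ) • Affine.Point.map (W' := P.legendreCurve.toAffine) φ T = 0
        rw [← map_zsmul, hT15, map_zero]
      have h3' : ∀ Q : geomTorsion P.legendreCurve ((3 : ℕ) : ℤ), τ • Q = Q := by
        intro Q
        have hQ := galoisRepTorsion_apply P.legendreCurve ((3 : ℕ) : ℤ) τ Q
        rw [(MonoidHom.mem_ker).1 h3ker] at hQ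
        exact hQ.symm
      have h5' : ∀ Q : geomTorsion P.legendreCurve ((5 : ℕ) : ℤ), τ • Q = Q := by
        intro Q
        have hQ := galoisRepTorsion_apply P.legendreCurve ((5 : ℕ) : ℤ) τ Q
        rw [(MonoidHom.mem_ker).1 h5ker] at hQ
        exact hQ.symm
      have hfix : τ • T' = T' := smul_eq_of_fifteen τ h3' h5' T' hT'
      refine forall_coords_of_smul_eq P τ T' hfix (φ x) ?_
      rcases T with _ | ⟨a, b, hab⟩
      · simp [pointCoords] at hxT
      · change φ x ∈ pointCoords (Affine.Point.map (W' := P.legendreCurve.toAffine) φ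
          (Affine.Point.some a b hab))
        rw [Affine.Point.map_some]
        simp only [pointCoords, Set.mem_insert_iff, Set.mem_singleton_iff] at hxT ⊢
        rcases hxT with rfl | rfl
        · exact Or.inl rfl
        · exact Or.inr rfl
  -- (3) `[I : I ∩ Γ_L] = #π(I) = ord(π s) ∣ 2k`
  have hrel : N₀.relIndex I ∣ 2 * k := by
    have hcard : N₀.relIndex I = Nat.card (I.map π.toMonoidHom) := by
      rw [← Subgroup.relIndex_ker I π.toMonoidHom, hπ, QuotientGroup.ker_mk']
    rw [hcard, hcyc, Nat.card_zpowers]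
    refine orderOf_dvd_of_pow_eq_one ?_
    rw [← map_pow]
    exact (QuotientGroup.eq_one_iff (s ^ (2 * k))).2 hs2k
  -- (4) `e(w | v)`, read on the inertia group of `Gal(L/F_tpd)`, divides `[I : I ∩ Γ_L]`
  set Q : Ideal (𝓞 L) := w.asIdeal.map (RingOfIntegers.mapAlgEquiv e : 𝓞 F ≃ₐ[𝓞 P.F] 𝓞 L) with hQ
  haveI : Q.IsPrime := isPrime_map_mapAlgEquiv e w
  haveI : Q.LiesOver v.asIdeal := liesOver_map_mapAlgEquiv e w _
  rw [← ramificationIdx_map_mapAlgEquiv e w]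
  set r : absoluteGaloisGroup P.F →* (L ≃ₐ[P.F] L) := AlgEquiv.restrictNormalHom L with hr
  have hker : r.ker = N₀ := IntermediateField.restrictNormalHom_ker L
  have h1 : (𝔓.comap (ringOfIntegersToIntegralClosure (k := P.F) (Ω := Ω) L)).inertia (L ≃ₐ[P.F] L) ≤
      I.map r := by
    intro g hg
    obtain ⟨σ, hσ, hσg⟩ := @exists_mem_inertia_restrict_eq P.F _ _ L _ _ 𝔓 h𝔓.1 g hg
    refine ⟨σ, hσ, AlgEquiv.ext fun x => Subtype.ext ?_⟩
    change (algebraMap L Ω) ((σ.restrictNormal L) x) = (algebraMap L Ω) (g x)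
    rw [AlgEquiv.restrictNormal_commutes]
    exact hσg x
  rw [@ramificationIdx_eq_card_inertia_comap P.F _ _ L _ _ v 𝔓 h𝔓.1 h𝔓.2 Q _ _]
  have hdvd : Nat.card ((𝔓.comap (ringOfIntegersToIntegralClosure (k := P.F) (Ω := Ω) L)).inertia
      (L ≃ₐ[P.F] L)) ∣ N₀.relIndex I := by
    have h := Subgroup.card_dvd_of_le h1
    rwa [← Subgroup.relIndex_ker I r, hker] at h
  exact hdvd.trans hrel

/-- **The Tate criterion at a multiplicative twist, transported to `E_λ`.** `P ∈ U`, `v ∤ p` a place of `F_tpd`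
(`p ∈ {3, 5, …}` a prime with `(p : 𝓞) ∉ v`), `d ≠ 0` with `E_λ^{(d)}` of multiplicative reduction at `v`, and
**`p ∣ ord_v j(λ)`** (so `p ∣ ord_v Δ_min(E_λ^{(d)}) = −ord_v j(E_λ^{(d)}) = −ord_v j(λ)`, the tree's
`natCast_dvd_log_valuation_j_iff` and `j_quadraticTwist`). Then every `σ ∈ I_𝔓` (`𝔓 | v`) fixing `√d` lies in
`ker ρ̄_{E_λ,p}`: `I_𝔓` fixes `E_λ^{(d)}[p]` pointwise (`smul_geomTorsion_eq_of_mem_inertia_of_hasMultiplicativeReductionAt_of_dvd`,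
Serre 1972 n° 1.12, unramified half) and the `Γ_{F_tpd(√d)}`-equivariant `E_λ^{(d)}(F̄) ≃+ E_λ(F̄)` carries this to `E_λ[p]`
(`ker_galoisRepTorsion_quadraticTwist_inf_stabilizer_le`). [cite: Serre1972, §1.11–§1.12] [cite: SilvermanAEC2009, X.5 Cor. 5.4] -/
theorem galoisRepTorsion_eq_one_of_mem_inertia_of_dvd_ord (hU : P.InU) {v : HeightOneSpectrum (𝓞 P.F)}
    {p : ℕ} (hp : p.Prime) (hpv : ((p : ℕ) : 𝓞 P.F) ∉ v.asIdeal) (hpord : (p : ℤ) ∣ ord P.F v (jInv P.x))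
    {d : P.F} (hd : d ≠ 0)
    (hmult : haveI : P.legendreCurve.IsElliptic := P.legendreCurve_isElliptic_iff.2 hU
      (P.legendreCurve.quadraticTwist d).HasMultiplicativeReductionAt v)
    {𝔓 : Ideal (absIntegers (𝓞 P.F) P.F)} (h𝔓 : 𝔓 ∈ v.primesAbove) {σ : absoluteGaloisGroup P.F}
    (hσ : σ ∈ 𝔓.inertia (absoluteGaloisGroup P.F)) (hσd : σ • geomSqrt d = geomSqrt d) :
    P.legendreCurve.galoisRepTorsion (p : ℤ) σ = 1 := by
  haveI : P.legendreCurve.IsElliptic := P.legendreCurve_isElliptic_iff.2 hU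
  haveI : (P.legendreCurve.quadraticTwist d).IsElliptic := P.legendreCurve.isElliptic_quadraticTwist hd
  -- `p ∣ ord_v Δ_min(E^{(d)})`
  have hjW : (P.legendreCurve.quadraticTwist d).j = jInv P.x := by
    rw [P.legendreCurve.j_quadraticTwist hd, j_legendre P hU]
  have hlog : (p : ℤ) ∣ WithZero.log (v.valuation P.F (P.legendreCurve.quadraticTwist d).j) := by
    rw [hjW]
    have h := (dvd_neg.2 hpord)
    rwa [show -ord P.F v (jInv P.x) = WithZero.log (v.valuation P.F (jInv P.x)) from by
      rw [ord, neg_neg]] at h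
  have hdvd : p ∣ (P.legendreCurve.quadraticTwist d).ordMinimalDiscriminant v :=
    ((P.legendreCurve.quadraticTwist d).natCast_dvd_log_valuation_j_iff v hmult p).1 hlog
  -- `I_𝔓` fixes `E^{(d)}[p]` pointwise
  have hker : σ ∈ ((P.legendreCurve.quadraticTwist d).galoisRepTorsion (p : ℤ)).ker := by
    rw [MonoidHom.mem_ker]
    refine Multiplicative.toAdd.injective (AddEquiv.ext fun Q => ?_)
    rw [galoisRepTorsion_apply]
    exact (P.legendreCurve.quadraticTwist d).smul_geomTorsion_eq_of_mem_inertia_of_hasMultiplicativeReductionAt_of_dvd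
      hmult hp hpv hdvd h𝔓 hσ Q
  -- transport to `E_λ[p]` on the stabiliser of `√d`
  have hle := P.legendreCurve.ker_galoisRepTorsion_quadraticTwist_inf_stabilizer_le (p : ℤ) hd
  exact (MonoidHom.mem_ker).1 (hle (Subgroup.mem_inf.2 ⟨hker, MulAction.mem_stabilizer_iff.2 hσd⟩))

/-- **`3 ∣ ord_v j(λ)` ⇒ `e(w | v) ∣ 10`** for every place `w` of a field pinned by `IsSubThetaField P F` (Galois over
`F_tpd`) over a BAD place `v ∤ 2·3·5` of `λ`: on `I_𝔓 ∩ Γ_{F_tpd(√d)}` the representation `ρ̄_{E_λ,3}` is TRIVIAL (Tate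
criterion, `3 ∣ ord_v Δ_min`) and `ρ̄_{E_λ,5}` unipotent, so `s^{10} = (s²)^5` fixes `F` in the cyclic-tame-inertia argument.
Numerically: `e ∈ {5, 10}` when `ord_v q ≡ 0 mod 3`, `≢ 0 mod 5` (TARGETS.tsv «genuine e_w»/l).
[cite: Serre1972, §1.11–§1.12] [cite: SerreLocalFields1979, Ch. IV §2 Cor. 1 and Cor. 3 of Prop. 7] -/
theorem ramificationIdx_subThetaField_dvd_ten_of_three_dvd_ord (hU : P.InU) (hF : IsSubThetaField P F) [IsGalois P.F F]
    (w : HeightOneSpectrum (𝓞 F)) (hbad : finBelow P.F F w ∈ badPlaces P)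
    (h30 : ((30 : ℕ) : 𝓞 P.F) ∉ (finBelow P.F F w).asIdeal)
    (h3ord : (3 : ℤ) ∣ ord P.F (finBelow P.F F w) (jInv P.x)) :
    w.asIdeal.ramificationIdx (𝓞 P.F) ∣ 10 := by
  haveI : P.legendreCurve.IsElliptic := P.legendreCurve_isElliptic_iff.2 hU
  have h3 : ((3 : ℕ) : 𝓞 P.F) ∉ (finBelow P.F F w).asIdeal := fun h => h30 (by
    rw [show (30 : ℕ) = 10 * 3 from rfl, Nat.cast_mul]; exact Ideal.mul_mem_left _ _ h)
  have h5 : ((5 : ℕ) : 𝓞 P.F) ∉ (finBelow P.F F w).asIdeal := fun h => h30 (by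
    rw [show (30 : ℕ) = 6 * 5 from rfl, Nat.cast_mul]; exact Ideal.mul_mem_left _ _ h)
  refine ramificationIdx_subThetaField_dvd_two_mul_of_forall_inertia F hU hF w hbad h30 5
    fun 𝔓 h𝔓 d hd hmult σ hσ hσd => ⟨?_, ?_⟩
  · rw [galoisRepTorsion_eq_one_of_mem_inertia_of_dvd_ord hU Nat.prime_three h3 (by exact_mod_cast h3ord) hd hmult
      h𝔓 hσ hσd, one_pow]
  · exact P.legendreCurve.galoisRepTorsion_pow_eq_one_of_mem_inertia_of_hasMultiplicativeReductionAt_quadraticTwist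
      Nat.prime_five hd hmult h5 h𝔓 hσ hσd

/-- **`5 ∣ ord_v j(λ)` ⇒ `e(w | v) ∣ 6`** for every place `w` of a field pinned by `IsSubThetaField P F` (Galois over
`F_tpd`) over a BAD place `v ∤ 2·3·5` of `λ`: `ρ̄_{E_λ,5}` is TRIVIAL on `I_𝔓 ∩ Γ_{F_tpd(√d)}` (Tate criterion) and
`ρ̄_{E_λ,3}` unipotent, so `s^6 = (s²)^3` fixes `F`. Numerically: `e ∈ {3, 6}` when `ord_v q ≡ 0 mod 5`, `≢ 0 mod 3`.
[cite: Serre1972, §1.11–§1.12] [cite: SerreLocalFields1979, Ch. IV §2 Cor. 1 and Cor. 3 of Prop. 7] -/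
theorem ramificationIdx_subThetaField_dvd_six_of_five_dvd_ord (hU : P.InU) (hF : IsSubThetaField P F) [IsGalois P.F F]
    (w : HeightOneSpectrum (𝓞 F)) (hbad : finBelow P.F F w ∈ badPlaces P)
    (h30 : ((30 : ℕ) : 𝓞 P.F) ∉ (finBelow P.F F w).asIdeal)
    (h5ord : (5 : ℤ) ∣ ord P.F (finBelow P.F F w) (jInv P.x)) :
    w.asIdeal.ramificationIdx (𝓞 P.F) ∣ 6 := by
  haveI : P.legendreCurve.IsElliptic := P.legendreCurve_isElliptic_iff.2 hU
  have h3 : ((3 : ℕ) : 𝓞 P.F) ∉ (finBelow P.F F w).asIdeal := fun h => h30 (by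
    rw [show (30 : ℕ) = 10 * 3 from rfl, Nat.cast_mul]; exact Ideal.mul_mem_left _ _ h)
  have h5 : ((5 : ℕ) : 𝓞 P.F) ∉ (finBelow P.F F w).asIdeal := fun h => h30 (by
    rw [show (30 : ℕ) = 6 * 5 from rfl, Nat.cast_mul]; exact Ideal.mul_mem_left _ _ h)
  refine ramificationIdx_subThetaField_dvd_two_mul_of_forall_inertia F hU hF w hbad h30 3
    fun 𝔓 h𝔓 d hd hmult σ hσ hσd => ⟨?_, ?_⟩
  · exact P.legendreCurve.galoisRepTorsion_pow_eq_one_of_mem_inertia_of_hasMultiplicativeReductionAt_quadraticTwist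
      Nat.prime_three hd hmult h3 h𝔓 hσ hσd
  · rw [galoisRepTorsion_eq_one_of_mem_inertia_of_dvd_ord hU Nat.prime_five h5 (by exact_mod_cast h5ord) hd hmult
      h𝔓 hσ hσd, one_pow]

/-- **`15 ∣ ord_v j(λ)` ⇒ `e(w | v) ∣ 2`** (both `ρ̄_{E_λ,3}` and `ρ̄_{E_λ,5}` trivial on `I_𝔓 ∩ Γ_{F_tpd(√d)}`; only the
twist character survives). [cite: Serre1972, §1.11–§1.12] [cite: SerreLocalFields1979, Ch. IV §2 Cor. 1 and Cor. 3 of Prop. 7] -/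
theorem ramificationIdx_subThetaField_dvd_two_of_fifteen_dvd_ord (hU : P.InU) (hF : IsSubThetaField P F) [IsGalois P.F F]
    (w : HeightOneSpectrum (𝓞 F)) (hbad : finBelow P.F F w ∈ badPlaces P)
    (h30 : ((30 : ℕ) : 𝓞 P.F) ∉ (finBelow P.F F w).asIdeal)
    (h15ord : (15 : ℤ) ∣ ord P.F (finBelow P.F F w) (jInv P.x)) :
    w.asIdeal.ramificationIdx (𝓞 P.F) ∣ 2 := by
  haveI : P.legendreCurve.IsElliptic := P.legendreCurve_isElliptic_iff.2 hU
  have h3 : ((3 : ℕ) : 𝓞 P.F) ∉ (finBelow P.F F w).asIdeal := fun h => h30 (by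
    rw [show (30 : ℕ) = 10 * 3 from rfl, Nat.cast_mul]; exact Ideal.mul_mem_left _ _ h)
  have h5 : ((5 : ℕ) : 𝓞 P.F) ∉ (finBelow P.F F w).asIdeal := fun h => h30 (by
    rw [show (30 : ℕ) = 6 * 5 from rfl, Nat.cast_mul]; exact Ideal.mul_mem_left _ _ h)
  have h3ord : (3 : ℤ) ∣ ord P.F (finBelow P.F F w) (jInv P.x) := (show (3 : ℤ) ∣ 15 by norm_num).trans h15ord
  have h5ord : (5 : ℤ) ∣ ord P.F (finBelow P.F F w) (jInv P.x) := (show (5 : ℤ) ∣ 15 by norm_num).trans h15ord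
  have h := ramificationIdx_subThetaField_dvd_two_mul_of_forall_inertia F hU hF w hbad h30 1
    fun 𝔓 h𝔓 d hd hmult σ hσ hσd => ⟨by
      rw [galoisRepTorsion_eq_one_of_mem_inertia_of_dvd_ord hU Nat.prime_three h3 (by exact_mod_cast h3ord) hd hmult
        h𝔓 hσ hσd, one_pow], by
      rw [galoisRepTorsion_eq_one_of_mem_inertia_of_dvd_ord hU Nat.prime_five h5 (by exact_mod_cast h5ord) hd hmult
        h𝔓 hσ hσd, one_pow]⟩
  simpa using h

end Cor22

end Literature.IUT.LogVolume

end
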